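import Mathlib
import Summits.KontsevichZagierPeriods.KontsevichZagierPeriods.Theses.InverseLandau
import Literature.NumberTheory.Transcendental.KZCalculus
import Literature.NumberTheory.Transcendental.KZLogCalculusProofs
import Literature.NumberTheory.Transcendental.KZProductIdeal
import Summits.KontsevichZagierPeriods.KontsevichZagierPeriods.Theorems.InverseLandauTateLiftingRotationSector
import Summits.KontsevichZagierPeriods.KontsevichZagierPeriods.Theorems.InverseLandauTateLiftingLowDimAlgSector
import Summits.KontsevichZagierPeriods.KontsevichZagierPeriods.Theorems.InverseLandauTateLiftingSphereArea
import Summits.KontsevichZagierPeriods.KontsevichZagierPeriods.Theorems.GenusOneIteratedLemniscaticSectorKernelLetters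

/-!
# `TateLifting` (stmt-KontsevichZagierPeriods-9129), line `Sketch` — stub `tateLifting_logTwoSpin`

`[D̄ × (1,2), 1/z₂] − [ℝ², ((1+2|w|²)(1+|w|²))⁻¹] ∈ KZ.relations` ("`π·log 2` two ways"): every
three-dimensional integral representation `ρ` with domain `{z₀² + z₁² ≤ 1, 1 < z₂ < 2}` (closed unit
disc times the interval `(1,2)`) and integrand `1/z₂` on it differs by relations of the
Kontsevich–Zagier calculus from every two-dimensional representation `R` with domain `ℝ²` and
integrand `((1 + 2(w₀² + w₁²))(1 + (w₀² + w₁²)))⁻¹`; both have value `π·log 2`. This is verbatim the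
item `LogTwoSpin` (stmt-KontsevichZagierPeriods-16461) of route SpheresForWalls.

## Proof (entirely inside the landed calculus)

* PRODUCT: `ρ` has the domain and (on it) the integrand of the Fubini product
  `KZ.piRep.prod J = [D̄, 1]·[J]` with `J = [(1,2) ⊆ ℝ¹, 1/x]` (`LogTwoSpin.exists_invRep`), so
  `[ρ] − [D̄]·[J] ∈ relations` by congruence (`KZ.of_mul_of`, `KZ.of_sub_of_mem_relations_of_eqOn`);
* ROTATION: `R` is invariant under the rotations of its two coordinates, so the landed rotation
  reduction `rotation_reduce` (`n = 0`: rotation engine + Fubini splitting + `PiNormalisation`) gives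
  the honest meridian `m = [(0,∞), 2r/((1+2r²)(1+r²))]` with `[R] − [m]·[D̄] ∈ relations`
  (`LogTwoSpin.exists_meridian`);
* DIMENSION ONE: `m` and `J` are dimension-one representations with rational integrands and the same
  value `log 2` (`∫₀^∞ 2r dr/((1+2r²)(1+r²)) = [log((1+2r²)/(1+r²))]₀^∞ = log 2`,
  `LogTwoSpin.integral_Ioi_meridian`; `∫₁² dx/x = log 2`), hence KZ-equivalent by the landed
  dimension-one algebraic-coefficient form of Conjecture 1, `kzPeriodConjecture_dim_one_algCoeff`
  (Baker inside the calculus — here only for `log 2 = log 2`);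
* PRODUCT STRUCTURE: `[D̄]·[J] ≡ [J]·[D̄]` (`KZ.of_mul_of_sub_of_mul_of_mem_relations`) and
  `[J]·[D̄] ≡ [m]·[D̄]` (right ideal, `KZ.mul_mem_relations_right_holds`); summing up,
  `[ρ] − [R] = ([ρ] − [D̄][J]) + ([D̄][J] − [J][D̄]) + ([J][D̄] − [m][D̄]) − ([R] − [m][D̄])`.

References: M. Kontsevich, D. Zagier, *Periods* (2001), §1.1, §1.2 (rules (1)–(3)), §4.1;
A. Baker, *Transcendental Number Theory* (1975), Thm 2.1 (through `kzPeriodConjecture_dim_one_algCoeff`).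
-/

noncomputable section

namespace Summit.KontsevichZagierPeriods.InverseLandau

open MeasureTheory Set Filter Topology
open Literature.NumberTheory.Transcendental
open Literature.ModelTheory.ExponentialFields (IsSemialgebraic)
open SphereChart
open Summit.KontsevichZagierPeriods.GenusOneIterated.LemniscaticSectorKernel (isSemialgebraic_I12)

namespace LogTwoSpin

/-! ## Two elementary integrals with value `log 2` -/

/-- **The meridian of `R` has value `log 2`**: `∫₀^∞ 2r dr/((1+2r²)(1+r²)) = log 2` (primitive
`log((1+2r²)/(1+r²))`, which vanishes at `0` and tends to `log 2` at infinity; FTC on the half-line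
`integral_Ioi_of_hasDerivAt_of_nonneg'`). [folklore] -/
theorem integral_Ioi_meridian :
    ∫ ρ in Ioi (0 : ℝ), 2 * ρ / ((1 + 2 * ρ ^ 2) * (1 + ρ ^ 2)) = Real.log 2 := by
  have hderiv : ∀ ρ ∈ Ici (0 : ℝ),
      HasDerivAt (fun ρ : ℝ => Real.log ((1 + 2 * ρ ^ 2) / (1 + ρ ^ 2)))
        (2 * ρ / ((1 + 2 * ρ ^ 2) * (1 + ρ ^ 2))) ρ := by
    intro ρ _
    have h1 : HasDerivAt (fun ρ : ℝ => 1 + ρ ^ 2) (2 * ρ) ρ :=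
      ((hasDerivAt_pow 2 ρ).const_add 1).congr_deriv (by norm_num)
    have h2 : HasDerivAt (fun ρ : ℝ => 1 + 2 * ρ ^ 2) (2 * (2 * ρ)) ρ :=
      (((hasDerivAt_pow 2 ρ).const_mul 2).const_add 1).congr_deriv (by norm_num)
    have hne1 : (1 + ρ ^ 2 : ℝ) ≠ 0 := by positivity
    have hne2 : (1 + 2 * ρ ^ 2 : ℝ) ≠ 0 := by positivity
    have hq : HasDerivAt (fun ρ : ℝ => (1 + 2 * ρ ^ 2) / (1 + ρ ^ 2))
        ((2 * (2 * ρ) * (1 + ρ ^ 2) - (1 + 2 * ρ ^ 2) * (2 * ρ)) / (1 + ρ ^ 2) ^ 2) ρ :=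
      h2.div h1 hne1
    refine (hq.log (div_ne_zero hne2 hne1)).congr_deriv ?_
    field_simp
    ring
  have hpos : ∀ ρ ∈ Ioi (0 : ℝ), 0 ≤ 2 * ρ / ((1 + 2 * ρ ^ 2) * (1 + ρ ^ 2)) := fun ρ hρ => by
    have hρ' : (0 : ℝ) < ρ := hρ
    positivity
  have hlim : Tendsto (fun ρ : ℝ => Real.log ((1 + 2 * ρ ^ 2) / (1 + ρ ^ 2))) atTop
      (𝓝 (Real.log 2)) := by
    have h : Tendsto (fun ρ : ℝ => 1 + ρ ^ 2) atTop atTop :=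
      tendsto_atTop_add_const_left _ _ (tendsto_pow_atTop two_ne_zero)
    have h2 : Tendsto (fun ρ : ℝ => (1 + 2 * ρ ^ 2) / (1 + ρ ^ 2)) atTop (𝓝 2) := by
      have e : (fun ρ : ℝ => (1 + 2 * ρ ^ 2) / (1 + ρ ^ 2)) = fun ρ => 2 - (1 + ρ ^ 2)⁻¹ := by
        funext ρ
        have hne1 : (1 + ρ ^ 2 : ℝ) ≠ 0 := by positivity
        field_simp
        ring
      rw [e]
      simpa using (tendsto_inv_atTop_zero.comp h).const_sub (2 : ℝ)
    exact (Real.continuousAt_log two_ne_zero).tendsto.comp h2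
  rw [integral_Ioi_of_hasDerivAt_of_nonneg' hderiv hpos hlim]
  simp

/-- **`∫_{(1,2)} dx/x = log 2` on `ℝ¹`** (transport `ℝ¹ → ℝ` by `MeasurableEquiv.funUnique`, then
`integral_inv_of_pos`). [folklore] -/
theorem setIntegral_fin_one_inv :
    ∫ p in {p : Fin 1 → ℝ | 1 < p 0 ∧ p 0 < 2}, (p 0)⁻¹ = Real.log 2 := by
  have h := (volume_preserving_funUnique (Fin 1) ℝ).setIntegral_preimage_emb
    (MeasurableEquiv.funUnique (Fin 1) ℝ).measurableEmbedding (fun x : ℝ => x⁻¹) (Ioo 1 2)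
  refine h.trans ?_
  rw [← integral_Ioc_eq_integral_Ioo, ← intervalIntegral.integral_of_le (by norm_num : (1:ℝ) ≤ 2),
    integral_inv_of_pos (by norm_num) (by norm_num)]
  norm_num

/-- `1/x` is absolutely integrable on `(1,2) ⊆ ℝ¹` (continuous on the compact `[1,2]`, transported
to `ℝ¹`). [folklore] -/
theorem integrableOn_fin_one_inv :
    IntegrableOn (fun p : Fin 1 → ℝ => (p 0)⁻¹) {p : Fin 1 → ℝ | 1 < p 0 ∧ p 0 < 2} := by
  have h : IntegrableOn (fun x : ℝ => x⁻¹) (Ioo 1 2) := by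
    have hc : ContinuousOn (fun x : ℝ => x⁻¹) (Icc 1 2) :=
      continuousOn_inv₀.mono fun x hx => (one_pos.trans_le hx.1).ne'
    exact (hc.integrableOn_compact isCompact_Icc).mono_set Ioo_subset_Icc_self
  exact ((volume_preserving_funUnique (Fin 1) ℝ).integrableOn_comp_preimage
    (MeasurableEquiv.funUnique (Fin 1) ℝ).measurableEmbedding).2 h

/-! ## The second factor `J = [(1,2), 1/x]` -/

/-- **The representation `J = [(1,2), 1/x]` of `log 2` exists**: domain `{1 < t₀ < 2} ⊆ ℝ¹`
(`ℚ`-semialgebraic: the tree's `LemniscaticSectorKernel.isSemialgebraic_I12`), integrand `t₀⁻¹`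
(semialgebraic as the quotient `1 / X₀`, `isSemialgebraicFunOn_aeval_div_aeval`; integrable by
`integrableOn_fin_one_inv`). Stated as an existence theorem. [folklore] -/
theorem exists_invRep :
    ∃ J : KZ.IntegralRep 1, J.domain = {t | 1 < t 0 ∧ t 0 < 2} ∧ J.integrand = fun t => (t 0)⁻¹ := by
  have hq : ∀ x ∈ {p : Fin 1 → ℝ | 1 < p 0 ∧ p 0 < 2},
      MvPolynomial.aeval x (MvPolynomial.X 0 : MvPolynomial (Fin 1) ℚ) ≠ 0 := fun x hx => by
    rw [MvPolynomial.aeval_X]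
    exact (one_pos.trans hx.1).ne'
  exact ⟨⟨{t | 1 < t 0 ∧ t 0 < 2}, fun t => (t 0)⁻¹, isSemialgebraic_I12,
    (isSemialgebraicFunOn_aeval_div_aeval isSemialgebraic_I12 1 (MvPolynomial.X 0) hq).congr
      fun t _ => by simp, integrableOn_fin_one_inv⟩, rfl, rfl⟩

/-! ## `[ρ] ≡ [D̄]·[J]` -/

/-- **`[D̄ × (1,2), 1/z₂] − [D̄]·[(1,2), 1/x] ∈ relations`**: `ρ` has the domain of the Fubini product
`KZ.piRep.prod J` (disc in the coordinates `0, 1`, the interval in the coordinate `2`) and, on it, its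
integrand `1 · (z₂)⁻¹`; congruence of representations (`KZ.of_sub_of_mem_relations_of_eqOn`) and
`KZ.of_mul_of`. [cite: KontsevichZagier2001, §4.1] -/
theorem of_sub_of_piRep_mul_mem_relations (ρ : KZ.IntegralRep 3) (J : KZ.IntegralRep 1)
    (hρd : ρ.domain = {z | z 0 ^ 2 + z 1 ^ 2 ≤ 1 ∧ 1 < z 2 ∧ z 2 < 2})
    (hρi : ∀ z ∈ ρ.domain, ρ.integrand z = (z 2)⁻¹)
    (hJd : J.domain = {t | 1 < t 0 ∧ t 0 < 2}) (hJi : J.integrand = fun t => (t 0)⁻¹) :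
    KZ.of ρ - KZ.of KZ.piRep * KZ.of J ∈ KZ.relations := by
  rw [KZ.of_mul_of]
  refine KZ.of_sub_of_mem_relations_of_eqOn ?_ fun z hz => ?_
  · rw [KZ.IntegralRep.prod_domain, hρd]
    ext z
    simp only [KZ.IntegralRep.mem_prodDomain, KZ.piRep_domain, KZ.mem_piDisc, hJd, mem_setOf_eq]
    exact Iff.rfl
  · rw [hρi z hz, KZ.IntegralRep.piRep_prod_integrand, KZ.IntegralRep.prodFun_apply,
      KZ.piRep_integrand, hJi, one_mul]
    rfl

/-! ## The meridian of `R` -/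

/-- **The honest meridian of `R = [ℝ², ((1+2|w|²)(1+|w|²))⁻¹]`**: `R` is invariant under the rotations
of its two coordinates (`(a w₀ − b w₁)² + (b w₀ + a w₁)² = w₀² + w₁²` for `a² + b² = 1`), so the landed
ROTATION REDUCTION `rotation_reduce` (`n = 0`) gives `m = [(0,∞), 2r/((1+2r²)(1+r²))]` with
`[R] − [m]·[D̄] ∈ relations`. [cite: KontsevichZagier2001, §1.2 rule (2)] -/
theorem exists_meridian (R : KZ.IntegralRep 2) (hRd : R.domain = Set.univ)
    (hRi : R.integrand = fun w => ((1 + 2 * (w 0 ^ 2 + w 1 ^ 2)) * (1 + (w 0 ^ 2 + w 1 ^ 2)))⁻¹) :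
    ∃ m : KZ.IntegralRep 1, m.domain = {p | 0 < p 0} ∧
      (m.integrand = fun p => 2 * p 0 / ((1 + 2 * p 0 ^ 2) * (1 + p 0 ^ 2))) ∧
      KZ.of R - KZ.of m * KZ.of KZ.piRep ∈ KZ.relations := by
  -- rotation invariance of `R`, in the binder shape of `rotation_reduce`
  have hinv : ∀ x ∈ R.domain, ∀ a b : ℝ, a ^ 2 + b ^ 2 = 1 →
      (Fin.snoc (Fin.snoc (Fin.init (Fin.init x : Fin 1 → ℝ) : Fin 0 → ℝ)
          (a * (Fin.init x : Fin 1 → ℝ) (Fin.last 0) - b * x (Fin.last 1)) : Fin 1 → ℝ)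
          (b * (Fin.init x : Fin 1 → ℝ) (Fin.last 0) + a * x (Fin.last 1)) : Fin 2 → ℝ) ∈ R.domain ∧
      R.integrand (Fin.snoc (Fin.snoc (Fin.init (Fin.init x : Fin 1 → ℝ) : Fin 0 → ℝ)
          (a * (Fin.init x : Fin 1 → ℝ) (Fin.last 0) - b * x (Fin.last 1)) : Fin 1 → ℝ)
          (b * (Fin.init x : Fin 1 → ℝ) (Fin.last 0) + a * x (Fin.last 1)) : Fin 2 → ℝ) =
        R.integrand x := by
    intro x _ a b hab
    refine ⟨by rw [hRd]; exact Set.mem_univ _, ?_⟩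
    have key : (a * x 0 - b * x 1) ^ 2 + (b * x 0 + a * x 1) ^ 2 = x 0 ^ 2 + x 1 ^ 2 := by
      linear_combination (x 0 ^ 2 + x 1 ^ 2) * hab
    simp only [hRi, rot_apply_zero, rot_apply_one, init_apply_last_zero, apply_last_one]
    rw [key]
  obtain ⟨m, hmd, hmi, hred⟩ : ∃ m : KZ.IntegralRep 1,
      m.domain = {p | 0 < p (Fin.last 0) ∧ (Fin.snoc p 0 : Fin 2 → ℝ) ∈ R.domain} ∧
      (m.integrand = fun p => 2 * p (Fin.last 0) * R.integrand (Fin.snoc p 0 : Fin 2 → ℝ)) ∧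
      KZ.of R - KZ.of m * KZ.of KZ.piRep ∈ KZ.relations :=
    rotation_reduce (n := 0) R hinv
  refine ⟨m, ?_, ?_, hred⟩
  · rw [hmd, hRd]
    ext p
    simp only [Set.mem_setOf_eq, Set.mem_univ, and_true, Fin.last_zero]
  · -- `(p, 0)₀ = p₀` and `(p, 0)₁ = 0` on `ℝ¹ × ℝ = ℝ²`
    have e0 : ∀ (v : Fin 1 → ℝ) (t : ℝ), (Fin.snoc v t : Fin 2 → ℝ) 0 = v 0 := fun _ _ => rfl
    have e1 : ∀ (v : Fin 1 → ℝ) (t : ℝ), (Fin.snoc v t : Fin 2 → ℝ) 1 = t := fun _ _ => rfl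
    rw [hmi, hRi]
    funext p
    simp only [Fin.last_zero, e0, e1]
    ring

/-! ## `[m] ≡ [J]`: dimension one, rational integrands, equal values -/

/-- Evaluation of the numerator `2X` of the meridian integrand. [folklore] -/
theorem eval_num (t : ℝ) :
    ((Polynomial.C 2 * Polynomial.X : Polynomial ℚ).map (algebraMap ℚ ℝ)).eval t = 2 * t := by
  simp

/-- Evaluation of the denominator `(1 + 2X²)(1 + X²)` of the meridian integrand. [folklore] -/
theorem eval_den (t : ℝ) :
    (((1 + Polynomial.C 2 * Polynomial.X ^ 2) * (1 + Polynomial.X ^ 2) : Polynomial ℚ).map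
      (algebraMap ℚ ℝ)).eval t = (1 + 2 * t ^ 2) * (1 + t ^ 2) := by
  simp

/-- Evaluation of the numerator `1` of `1/x`. [folklore] -/
theorem eval_one_map (t : ℝ) : ((1 : Polynomial ℚ).map (algebraMap ℚ ℝ)).eval t = 1 := by
  simp

/-- Evaluation of the denominator `X` of `1/x`. [folklore] -/
theorem eval_X_map (t : ℝ) : ((Polynomial.X : Polynomial ℚ).map (algebraMap ℚ ℝ)).eval t = t := by
  simp

/-- **`[(0,∞), 2r/((1+2r²)(1+r²))] ∼ [(1,2), 1/x]`**: two dimension-one representations with rational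
integrands (read in `ℝ[X]` with rational, hence `ℚ`-algebraic, coefficients) and the same value `log 2`
are KZ-equivalent by the landed two-representation form `kzPeriodConjecture_dim_one_algCoeff` of
Conjecture 1 in dimension one. [cite: Baker1975, Thm 2.1] -/
theorem meridian_equivalent_invRep (m J : KZ.IntegralRep 1) (hmd : m.domain = {p | 0 < p 0})
    (hmi : m.integrand = fun p => 2 * p 0 / ((1 + 2 * p 0 ^ 2) * (1 + p 0 ^ 2)))
    (hJd : J.domain = {t | 1 < t 0 ∧ t 0 < 2}) (hJi : J.integrand = fun t => (t 0)⁻¹) :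
    KZ.Equivalent m J := by
  have hvm : m.value = Real.log 2 := by
    rw [KZ.IntegralRep.value, hmd, hmi]
    exact (setIntegral_fin_one_Ioi (fun ρ => 2 * ρ / ((1 + 2 * ρ ^ 2) * (1 + ρ ^ 2)))).trans
      integral_Ioi_meridian
  have hvJ : J.value = Real.log 2 := by
    rw [KZ.IntegralRep.value, hJd, hJi]
    exact setIntegral_fin_one_inv
  refine kzPeriodConjecture_dim_one_algCoeff m J
    ((Polynomial.C 2 * Polynomial.X : Polynomial ℚ).map (algebraMap ℚ ℝ))
    (((1 + Polynomial.C 2 * Polynomial.X ^ 2) * (1 + Polynomial.X ^ 2) : Polynomial ℚ).map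
      (algebraMap ℚ ℝ))
    ((1 : Polynomial ℚ).map (algebraMap ℚ ℝ)) ((Polynomial.X : Polynomial ℚ).map (algebraMap ℚ ℝ))
    (isAlgebraic_coeff_map _) (isAlgebraic_coeff_map _) (fun x _ => ?_) (fun x _ => ?_)
    (isAlgebraic_coeff_map _) (isAlgebraic_coeff_map _) (fun x hx => ?_) (fun x _ => ?_)
    (hvm.trans hvJ.symm)
  · rw [eval_den]; positivity
  · simp only [hmi, eval_num, eval_den]
  · rw [eval_X_map]
    rw [hJd] at hx
    exact (one_pos.trans hx.1).ne'
  · simp only [hJi, eval_one_map, eval_X_map, one_div]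

end LogTwoSpin

open LogTwoSpin

/-! ## The stub -/

/-- **`[D̄ × (1,2), 1/z₂] − [ℝ², ((1+2|w|²)(1+|w|²))⁻¹] ∈ KZ.relations`** (stub `tateLifting_logTwoSpin`
of line `Sketch`, crux `TateLifting`; verbatim item `LogTwoSpin`, stmt-KontsevichZagierPeriods-16461, of
route SpheresForWalls; "`π·log 2` two ways"): a representation `ρ = [{z₀²+z₁² ≤ 1, 1 < z₂ < 2}, 1/z₂]`
and a representation `R = [ℝ², ((1 + 2(w₀²+w₁²))(1 + (w₀²+w₁²)))⁻¹]` differ by relations of the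
Kontsevich–Zagier calculus. `ρ` is congruent to the Fubini product `[D̄]·[J]`, `J = [(1,2), 1/x]`
(`of_sub_of_piRep_mul_mem_relations`); `R` reduces by the rotation reduction `rotation_reduce` to
`[m]·[D̄]` with the honest meridian `m = [(0,∞), 2r/((1+2r²)(1+r²))]` (`exists_meridian`); `m ∼ J` by
the dimension-one algebraic-coefficient form of Conjecture 1 (`kzPeriodConjecture_dim_one_algCoeff`,
both values `log 2`); and `[D̄]·[J] ≡ [J]·[D̄] ≡ [m]·[D̄]` by the product structure of `KZ.relations`
(`KZ.of_mul_of_sub_of_mul_of_mem_relations`, `KZ.mul_mem_relations_right_holds`).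
[cite: KontsevichZagier2001, §1.2] -/
theorem tateLifting_logTwoSpin :
    ∀ (ρ : KZ.IntegralRep 3) (R : KZ.IntegralRep 2), ρ.domain = {z | z 0 ^ 2 + z 1 ^ 2 ≤ 1 ∧ 1 < z 2 ∧ z 2 < 2} → (∀ z ∈ ρ.domain, ρ.integrand z = (z 2)⁻¹) → R.domain = Set.univ → (R.integrand = fun w => ((1 + 2 * (w 0 ^ 2 + w 1 ^ 2)) * (1 + (w 0 ^ 2 + w 1 ^ 2)))⁻¹) → KZ.of ρ - KZ.of R ∈ KZ.relations := by
  intro ρ R hρd hρi hRd hRi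
  obtain ⟨J, hJd, hJi⟩ := exists_invRep
  obtain ⟨m, hmd, hmi, hred⟩ := exists_meridian R hRd hRi
  have h1 : KZ.of ρ - KZ.of KZ.piRep * KZ.of J ∈ KZ.relations :=
    of_sub_of_piRep_mul_mem_relations ρ J hρd hρi hJd hJi
  have h2 : KZ.of KZ.piRep * KZ.of J - KZ.of J * KZ.of KZ.piRep ∈ KZ.relations :=
    KZ.of_mul_of_sub_of_mul_of_mem_relations _ _
  have hJm : KZ.of J - KZ.of m ∈ KZ.relations := (meridian_equivalent_invRep m J hmd hmi hJd hJi).symm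
  have h3 : KZ.of J * KZ.of KZ.piRep - KZ.of m * KZ.of KZ.piRep ∈ KZ.relations := by
    rw [← sub_mul]
    exact KZ.mul_mem_relations_right_holds _ _ hJm
  have key : KZ.of ρ - KZ.of R = (KZ.of ρ - KZ.of KZ.piRep * KZ.of J) +
      (KZ.of KZ.piRep * KZ.of J - KZ.of J * KZ.of KZ.piRep) +
      (KZ.of J * KZ.of KZ.piRep - KZ.of m * KZ.of KZ.piRep) - (KZ.of R - KZ.of m * KZ.of KZ.piRep) := by
    abel
  rw [key]
  exact KZ.relations.sub_mem (KZ.relations.add_mem (KZ.relations.add_mem h1 h2) h3) hred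

end Summit.KontsevichZagierPeriods.InverseLandau

end
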